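import Summits.BirchSwinnertonDyer.Rank1Residual.X11b.IntSeriesValueRigidity
import Literature.NumberTheory.EllipticCurves.Rubin1991.TwoVariableMainConjecture
import Literature.NumberTheory.EllipticCurves.Hida2010MuInvariant.AnticyclotomicKatzBranchMuInvariant
import HarnessLib

/-!
# Inner evaluation of a two-variable `𝒪_{ℂ_p}`-series at a point of the maximal ideal: existence,
# Fubini, and invariance of the reduction mod `𝔪` (bricks (J3)/(J4) of the [BRω] road)
# (helper file 31 for crux 2 `GoodLatticeBDPValue`, stmt-BirchSwinnertonDyer-19032, cell `bsd-eis` seat `bsd-eis-k5-c2`)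

For `G ∈ 𝒪_{ℂ_p}⟦T₁⟧⟦T₂⟧` (`PowerSeries (PowerSeries 𝒪_{ℂ_p})`, OUTER variable `T₁`, inner `T₂`, the
currency of `Rubin1991.IsKatzMeasure₂` / `IntSeries.HasValueAt₂`) and a point `c` of the open unit disc
of `ℂ_p`:

* `intSeries_norm_value_le_one`, `intSeries_norm_value_sub_constantCoeff_le` — a value of a
  one-variable `𝒪_{ℂ_p}`-series on the open disc has norm `≤ 1`, and differs from the constant term by
  at most `‖c‖` (ultrametric estimate of the tail);
* `exists_innerEval` — there is `Q ∈ 𝒪_{ℂ_p}⟦T₁⟧` whose `k`-th coefficient IS the value of the `k`-th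
  outer coefficient `[T₁^k]G ∈ 𝒪_{ℂ_p}⟦T₂⟧` at `T₂ = c` ("`Q = G(T₁, c)`", the partial evaluation of the
  inner variable — stated through `IntSeries.HasValueAt`, no new definition);
* `hasValueAt_of_hasValueAt₂_of_innerEval` — FUBINI: `G` has value `w` at `(x, c)` ⟹ `Q` has value
  `w` at `x` (`HasSum.prod_fiberwise` on the absolutely convergent double series);
* `map_residue_innerEval_eq` — REDUCTION MOD `𝔪`: `Q ≡ G(T₁, 0) (mod 𝔪_{𝒪_{ℂ_p}})` coefficientwise,
  i.e. `Q.map residue = (G.map constantCoeff).map residue` (the tail `∑_{j ≥ 1} a_{kj} c^j` has norm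
  `≤ ‖c‖ < 1`), hence `Q` and the slice `G(T₁, 0)` have the same unit content and the same order of
  reduction (`λ` when `μ = 0`).

WHY (HOME/k5-c2-MEMO-6.md §4, (J3)–(J4)): along the two-variable road to [BRω] one compares the
anticyclotomic slice `G_ω(T₁, 0)` of the `ω̃_K⁻¹`-branch witness with the slice of the reflected
`𝟙̃_K⁻¹`-branch witness TRANSLATED by the character `ρ' = ω_K·N_K` through the tower; after choosing the
anticyclotomic generator in `ker ρ̂'` the translation is purely in the INNER variable, `T₂ = c := ρ̂'(γ'⁻¹) − 1 ∈ 𝔪`,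
so the comparison is between `G_ω(T₁, c)` (this file's `Q`) and a slice at `0`; rigidity
(`R1.intSeries_eq_of_hasValueAt`) identifies them, and this file's mod-`𝔪` invariance carries the
verdict back to `G_ω(T₁, 0)`. Pure `p`-adic analysis; no fact, no definition; nothing about BSD.
References: de Shalit 1987 II.4.17 (54) (two-variable series `G(χ; T₁, T₂)`); Cassels, *Local Fields*,
Ch. 4 (Strassmann / values on the open disc); HOME/k5-c2-MEMO-6.md §4.
-/

-- the summit namespace `Summit.BirchSwinnertonDyer.BirchSwinnertonDyer` repeats the problem name by design (D-0017)
set_option linter.dupNamespace false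
set_option autoImplicit false

noncomputable section

open scoped Classical Topology

open Filter PowerSeries Literature.NumberTheory.EllipticCurves
  Summit.BirchSwinnertonDyer.Rank1Residual.X11b

namespace Summit.BirchSwinnertonDyer.BirchSwinnertonDyer.Theorems.IwasawaTwoVariable

section InnerEval

variable {p : ℕ} [Fact p.Prime]

/-- A value of `Q ∈ 𝒪_{ℂ_p}⟦T⟧` at a point of the open unit disc has norm `≤ 1` (ultrametric:
every term has norm `≤ ‖x‖^k ≤ 1`). [cite: Cassels1986, Ch. 4 Lemma 2.1] -/
theorem intSeries_norm_value_le_one {Q : PowerSeries 𝓞_ℂ_[p]} {x v : ℂ_[p]} (hx : ‖x‖ < 1)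
    (h : IntSeries.HasValueAt Q x v) : ‖v‖ ≤ 1 := by
  rw [← h.tsum_eq]
  refine IsUltrametricDist.norm_tsum_le_of_forall_le_of_nonneg zero_le_one fun k ↦ ?_
  exact (intSeries_norm_coeff_mul_pow_le Q x k).trans (pow_le_one₀ (norm_nonneg _) hx.le)

/-- The value of `Q ∈ 𝒪_{ℂ_p}⟦T⟧` at `x` differs from the constant term `Q(0)` by at most `‖x‖`
(the tail `∑_{k ≥ 1} [T^k]Q · x^k` has every term of norm `≤ ‖x‖^{k+1} ≤ ‖x‖`).
[cite: Cassels1986, Ch. 4 Lemma 2.1] -/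
theorem intSeries_norm_value_sub_constantCoeff_le {Q : PowerSeries 𝓞_ℂ_[p]} {x v : ℂ_[p]}
    (hx : ‖x‖ < 1) (h : IntSeries.HasValueAt Q x v) :
    ‖v - ((PowerSeries.constantCoeff Q : 𝓞_ℂ_[p]) : ℂ_[p])‖ ≤ ‖x‖ := by
  have htail : HasSum (fun k : ℕ ↦ ((PowerSeries.coeff (k + 1) Q : 𝓞_ℂ_[p]) : ℂ_[p]) * x ^ (k + 1))
      (v - ((PowerSeries.constantCoeff Q : 𝓞_ℂ_[p]) : ℂ_[p])) := by
    have h1 := (hasSum_nat_add_iff' (f := fun k : ℕ ↦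
      ((PowerSeries.coeff k Q : 𝓞_ℂ_[p]) : ℂ_[p]) * x ^ k) 1).mpr h
    simpa [Finset.sum_range_one, PowerSeries.coeff_zero_eq_constantCoeff] using h1
  rw [← htail.tsum_eq]
  refine IsUltrametricDist.norm_tsum_le_of_forall_le_of_nonneg (norm_nonneg x) fun k ↦ ?_
  calc ‖((PowerSeries.coeff (k + 1) Q : 𝓞_ℂ_[p]) : ℂ_[p]) * x ^ (k + 1)‖
      ≤ ‖x‖ ^ (k + 1) := intSeries_norm_coeff_mul_pow_le Q x (k + 1)
    _ ≤ ‖x‖ := by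
        rw [pow_succ]
        exact mul_le_of_le_one_left (norm_nonneg _) (pow_le_one₀ (norm_nonneg _) hx.le)

/-- **Inner evaluation exists**: for `G ∈ 𝒪_{ℂ_p}⟦T₁⟧⟦T₂⟧` and `‖c‖ < 1` there is `Q ∈ 𝒪_{ℂ_p}⟦T₁⟧`
with `[T₁^k]Q = ([T₁^k]G)(c)` for every `k` — "`Q = G(T₁, c)`". (Values on the open disc exist,
`intSeries_exists_hasValueAt`, and have norm `≤ 1`.) [cite: deShalit1987, II.4.17 (54) (store chunk 78)] -/
theorem exists_innerEval (G : PowerSeries (PowerSeries 𝓞_ℂ_[p])) {c : ℂ_[p]} (hc : ‖c‖ < 1) :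
    ∃ Q : PowerSeries 𝓞_ℂ_[p], ∀ k : ℕ,
      IntSeries.HasValueAt (PowerSeries.coeff k G) c ((PowerSeries.coeff k Q : 𝓞_ℂ_[p]) : ℂ_[p]) := by
  choose v hv using fun k : ℕ ↦ intSeries_exists_hasValueAt (PowerSeries.coeff k G) hc
  have hmem : ∀ k, v k ∈ 𝓞_ℂ_[p] := fun k ↦
    Literature.NumberTheory.LFunctions.Dwork.mem_unitBall.mpr (intSeries_norm_value_le_one hc (hv k))
  refine ⟨PowerSeries.mk fun k ↦ ⟨v k, hmem k⟩, fun k ↦ ?_⟩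
  rw [PowerSeries.coeff_mk]
  exact hv k

/-- **Fubini for the inner evaluation**: if `G` has value `w` at `(x, c)` (`IntSeries.HasValueAt₂`, the
absolutely convergent double sum) and `Q = G(T₁, c)` coefficientwise, then `Q` has value `w` at `x`.
[cite: deShalit1987, II.4.17 (54) (store chunk 78)] -/
theorem hasValueAt_of_hasValueAt₂_of_innerEval {G : PowerSeries (PowerSeries 𝓞_ℂ_[p])}
    {Q : PowerSeries 𝓞_ℂ_[p]} {x c w : ℂ_[p]}
    (hQ : ∀ k : ℕ,
      IntSeries.HasValueAt (PowerSeries.coeff k G) c ((PowerSeries.coeff k Q : 𝓞_ℂ_[p]) : ℂ_[p]))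
    (hG : IntSeries.HasValueAt₂ G x c w) : IntSeries.HasValueAt Q x w := by
  unfold IntSeries.HasValueAt₂ at hG
  unfold IntSeries.HasValueAt
  refine hG.prod_fiberwise fun k ↦ ?_
  -- the `k`-th fibre: `∑_j a_{kj} x^k c^j = ([T₁^k]G)(c) · x^k`
  have h := (hQ k).mul_right (x ^ k)
  refine h.congr_fun fun j ↦ ?_
  dsimp only
  ring

/-- **The inner evaluation at a point of `𝔪` reduces to the slice at `0` modulo `𝔪`**: if
`Q = G(T₁, c)` with `‖c‖ < 1`, then `Q.map residue = (G.map constantCoeff).map residue` in `𝔽̄_p⟦T₁⟧`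
(coefficientwise `([T₁^k]G)(c) − ([T₁^k]G)(0)` has norm `≤ ‖c‖ < 1`, i.e. lies in `𝔪_{𝒪_{ℂ_p}}`).
Consequently `Q` and `G(T₁, 0)` have the same unit content and, when it holds, the same order of
reduction. [cite: GreenbergVatsal2000, p. 2, (1)–(2) (μ = 0 and λ read on the reduction mod 𝔪)] -/
theorem map_residue_innerEval_eq {G : PowerSeries (PowerSeries 𝓞_ℂ_[p])}
    {Q : PowerSeries 𝓞_ℂ_[p]} {c : ℂ_[p]} (hc : ‖c‖ < 1)
    (hQ : ∀ k : ℕ,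
      IntSeries.HasValueAt (PowerSeries.coeff k G) c ((PowerSeries.coeff k Q : 𝓞_ℂ_[p]) : ℂ_[p])) :
    PowerSeries.map (IsLocalRing.residue 𝓞_ℂ_[p]) Q =
      PowerSeries.map (IsLocalRing.residue 𝓞_ℂ_[p])
        (PowerSeries.map (PowerSeries.constantCoeff (R := 𝓞_ℂ_[p])) G) := by
  ext k
  simp only [PowerSeries.coeff_map]
  rw [← sub_eq_zero, ← map_sub, IsLocalRing.residue_eq_zero_iff, IsLocalRing.mem_maximalIdeal,
    mem_nonunits_iff, isUnit_padicComplexInt_iff]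
  have hle := intSeries_norm_value_sub_constantCoeff_le hc (hQ k)
  have hlt : ‖((PowerSeries.coeff k Q : 𝓞_ℂ_[p]) : ℂ_[p]) -
      ((PowerSeries.constantCoeff (PowerSeries.coeff k G) : 𝓞_ℂ_[p]) : ℂ_[p])‖ < 1 :=
    hle.trans_lt hc
  intro h1
  rw [AddSubgroupClass.coe_sub] at h1
  exact absurd h1 hlt.ne

/-- **Same unit content** for the inner evaluation at a point of `𝔪` and the slice at `0`.
[cite: GreenbergVatsal2000, p. 2, (2)] -/
theorem map_residue_innerEval_ne_zero_iff {G : PowerSeries (PowerSeries 𝓞_ℂ_[p])}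
    {Q : PowerSeries 𝓞_ℂ_[p]} {c : ℂ_[p]} (hc : ‖c‖ < 1)
    (hQ : ∀ k : ℕ,
      IntSeries.HasValueAt (PowerSeries.coeff k G) c ((PowerSeries.coeff k Q : 𝓞_ℂ_[p]) : ℂ_[p])) :
    PowerSeries.map (IsLocalRing.residue 𝓞_ℂ_[p]) Q ≠ 0 ↔
      PowerSeries.map (IsLocalRing.residue 𝓞_ℂ_[p])
        (PowerSeries.map (PowerSeries.constantCoeff (R := 𝓞_ℂ_[p])) G) ≠ 0 := by
  rw [map_residue_innerEval_eq hc hQ]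

/-- **Same order of reduction** (the `λ`-invariant when `μ = 0`) for the inner evaluation at a point of
`𝔪` and the slice at `0`. [cite: GreenbergVatsal2000, p. 2, (1)–(2)] -/
theorem order_map_residue_innerEval_eq {G : PowerSeries (PowerSeries 𝓞_ℂ_[p])}
    {Q : PowerSeries 𝓞_ℂ_[p]} {c : ℂ_[p]} (hc : ‖c‖ < 1)
    (hQ : ∀ k : ℕ,
      IntSeries.HasValueAt (PowerSeries.coeff k G) c ((PowerSeries.coeff k Q : 𝓞_ℂ_[p]) : ℂ_[p])) :
    (PowerSeries.map (IsLocalRing.residue 𝓞_ℂ_[p]) Q).order =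
      (PowerSeries.map (IsLocalRing.residue 𝓞_ℂ_[p])
        (PowerSeries.map (PowerSeries.constantCoeff (R := 𝓞_ℂ_[p])) G)).order := by
  rw [map_residue_innerEval_eq hc hQ]

end InnerEval

end Summit.BirchSwinnertonDyer.BirchSwinnertonDyer.Theorems.IwasawaTwoVariable

end
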